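import Summits.Ventures.PackingBounds.ThreePointCert.C5TCert

/-!
# A(5, arccos 1/3) ≤ 23 (three-point bound, kernel-checked): kernel validation of Gram block R0 (chunks 13–16 of 16)

Framing: lottery ticket; floor = certified bounds/negative ranges. Venture `PackingBounds` (cell
`pub-packcert`), three-point SDP family. Integer data of a feasible point of the Bachoc–Vallentin
semidefinite program (n = 5, s = 1/3, degree d = 8, symmetric
sums of squares), derived by `pub-packcert-sdp/code/cert2lean.py` from the exact rational
certificate `sdp-n5-d8-s1-3-sym.json` of the cell (two independent exact verifiers + referee), in the
units of the kernel checker `ThreePointCert.Check` (soundness `ThreePointCert.Sound`). Generated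
file: plain lists of integers / monomials.
-/

namespace Summit.Ventures.PackingBounds.ThreePointCert.C5T

open Literature.Geometry.DiscreteGeometry Literature.Geometry.DiscreteGeometry.PolyCert PolyCert.SPoly

set_option maxHeartbeats 0 in
/-- Block `R0`: rows from 138 (7 rows) of `zᵀ(LLᵀ)z` added to `dR0c12` give `dR0c13` (kernel). -/
theorem okR0_13 : chunkOK C5T.gR0 138 7 C5T.dR0c12 C5T.dR0c13 = true := by
  decide +kernel

set_option maxHeartbeats 0 in
/-- Block `R0`: rows from 145 (7 rows) of `zᵀ(LLᵀ)z` added to `dR0c13` give `dR0c14` (kernel). -/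
theorem okR0_14 : chunkOK C5T.gR0 145 7 C5T.dR0c13 C5T.dR0c14 = true := by
  decide +kernel

set_option maxHeartbeats 0 in
/-- Block `R0`: rows from 152 (7 rows) of `zᵀ(LLᵀ)z` added to `dR0c14` give `dR0c15` (kernel). -/
theorem okR0_15 : chunkOK C5T.gR0 152 7 C5T.dR0c14 C5T.dR0c15 = true := by
  decide +kernel

set_option maxHeartbeats 0 in
/-- Block `R0`: rows from 159 ((gR0.z.length - 159) rows) of `zᵀ(LLᵀ)z` added to `dR0c15` give `eR0` (kernel). -/
theorem okR0_16 : chunkOK C5T.gR0 159 (C5T.gR0.z.length - 159) C5T.dR0c15 C5T.eR0 = true := by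
  decide +kernel

end Summit.Ventures.PackingBounds.ThreePointCert.C5T
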